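import Mathlib
import Summits.NavierStokesRegularity.NavierStokesRegularity.Theorems.SlicedKelvinPlanarFluxAPrioriDecayBootstrapStep

/-!
# Crux `SlicedKelvin.PlanarFluxAPriori` (stmt-NavierStokesRegularity-15600), line `registered`,
# stub `stub_decayPersistence` — the weighted bootstrap along the Oseen formulation

Support file (theorems only). The abstract propagation-of-decay step of the decay-persistence
stub (Brandolese 2004; Kukavica–Torres 2006): a bounded field `g` on `[0, T₁] × ℝ³` which is
represented through the Oseen (mild) formula

  `g(τ) = e^{ντΔ} g(0) - Σᵢ B^ν_0(aᵢ, bᵢ)(τ)`,    `0 < τ ≤ T₁`,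

by finitely many Duhamel terms of bounded fields `aᵢ`, `bᵢ`, each pair containing either `g`
itself or a field with a known cubic decay bound, inherits the cubic decay of `g(0)`:
`(1 + |x|)³ |g(τ, x)| ≤ C` on `[0, T₁] × ℝ³`, with `C` depending only on the bounds
(`decay_weighted_bootstrap`). The proof runs the Gronwall argument on the truncated weights
`w_R = (min (1 + |x|) R)³` (for which all weighted suprema are finite) through the one-step
inequality `decay_bootstrap_step`, with a step `δ` chosen so that the singular part
`∫_{τ-δ}^τ (ν(τ-σ))^{-1/2} dσ` of the Volterra kernel absorbs into the left-hand side, and an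
induction over `⌈T₁/δ⌉` steps against the explicit envelope `(2α + qA₀)(1 + q)^k`; the bound is
uniform in `R`, and `R = 1 + |x|` recovers the full weight.

## References

* L. Brandolese, *Space-time decay of Navier–Stokes flows invariant under rotations*,
  Math. Ann. 329 (2004) = arXiv:math/0403136.
* I. Kukavica, J. J. Torres, *Weighted bounds for the velocity and the vorticity for the
  Navier–Stokes equations*, Nonlinearity 19 (2006).
* G. Koch, N. Nadirashvili, G. Seregin, V. Šverák, Acta Math. 203 (2009), §3 (3.8), §4.
-/

noncomputable section

-- the summit and its single sub-problem share the name (CONVENTIONS §1), as in every Theorems file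
set_option linter.dupNamespace false

namespace Summit.NavierStokesRegularity.NavierStokesRegularity.Theorems.SlicedKelvinPlanarFluxAPriori

open MeasureTheory Set Filter Topology Metric Real
open scoped ENNReal NNReal
open Literature.Analysis.FluidPDE Literature.Analysis.UnboundedOperators

/-! ### The bootstrap -/

/-- **Propagation of the cubic weight along an Oseen representation (the weighted Gronwall
argument of Brandolese 2004 / Kukavica–Torres 2006, abstract form).** Fix `ν, T₁ > 0`, bounds
`L, A₀, A₁ ≥ 0` and a number of terms `n`. There is `C` such that: whenever a field `g` on
`[0, T₁] × ℝ³`, bounded by `L`, with `g(0)` continuous and `(1 + |x|)³ |g(0, x)| ≤ A₀`, is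
represented for `0 < τ ≤ T₁` as `g(τ) = e^{ντΔ} g(0) - Σᵢ B^ν_0(aᵢ, bᵢ)(τ)` by at most `n` pairs
of fields bounded by `L` on `[0, T₁]`, each pair having a component equal to `g` or a component
with `(1 + |y|)³ |·| ≤ A₁` on `[0, T₁]`, then `(1 + |x|)³ |g(τ, x)| ≤ C` on `[0, T₁] × ℝ³`. -/
theorem decay_weighted_bootstrap :
    ∀ (ν T₁ L A₀ A₁ : ℝ) (n : ℕ), 0 < ν → 0 < T₁ → 0 ≤ L → 0 ≤ A₀ → 0 ≤ A₁ →
    ∃ C : ℝ, ∀ {ι : Type} [Fintype ι]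
      (g : ℝ → EuclideanSpace ℝ (Fin 3) → EuclideanSpace ℝ (Fin 3))
      (a b : ι → ℝ → EuclideanSpace ℝ (Fin 3) → EuclideanSpace ℝ (Fin 3)),
      Fintype.card ι ≤ n → Continuous (g 0) →
      (∀ x, (1 + ‖x‖) ^ 3 * ‖g 0 x‖ ≤ A₀) →
      (∀ τ ∈ Set.Icc 0 T₁, ∀ x, ‖g τ x‖ ≤ L) →
      (∀ i, (∀ τ ∈ Set.Icc 0 T₁, ∀ y, ‖a i τ y‖ ≤ L ∧ ‖b i τ y‖ ≤ L) ∧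
        (a i = g ∨ b i = g ∨ (∀ τ ∈ Set.Icc 0 T₁, ∀ y, (1 + ‖y‖) ^ 3 * ‖a i τ y‖ ≤ A₁) ∨
          (∀ τ ∈ Set.Icc 0 T₁, ∀ y, (1 + ‖y‖) ^ 3 * ‖b i τ y‖ ≤ A₁))) →
      (∀ τ ∈ Set.Ioc 0 T₁, ∀ x, g τ x =
        Literature.Analysis.UnboundedOperators.heatExtension (g 0) (ν * τ) x -
          ∑ i, Literature.Analysis.FluidPDE.oseenDuhamel ν 0 (a i) (b i) τ x) →
      ∀ τ ∈ Set.Icc 0 T₁, ∀ x, (1 + ‖x‖) ^ 3 * ‖g τ x‖ ≤ C := by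
  intro ν T₁ L A₀ A₁ n hν hT₁ hL hA₀ hA₁
  -- the constants
  obtain ⟨C₀, hC₀, hK⟩ := exists_norm_oseenKernel_three_le
  obtain ⟨C_K, hC_K, hW⟩ := decay_lintegral_oseenWeight_le
  obtain ⟨C_G, hC_G, hG⟩ := decay_weighted_heatExtension_le
  have hν12 : 0 < ν ^ (-(1 / 2 : ℝ)) := Real.rpow_pos_of_pos hν _
  set β : ℝ := n * (C₀ * C_K * L) with hβ
  have hβ0 : 0 ≤ β := by positivity
  -- the step `δ`: `β (2 ν^{-1/2} √δ + δ) ≤ 1/2`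
  set δ : ℝ := min (ν / (64 * (β + 1) ^ 2)) (1 / (4 * (β + 1))) with hδ
  have hδ0 : 0 < δ := lt_min (by positivity) (by positivity)
  have hβI : β * (2 * ν ^ (-(1 / 2 : ℝ)) * Real.sqrt δ + δ) ≤ 1 / 2 := by
    have hb1 : 0 < β + 1 := by linarith
    have hδ1 : δ ≤ ν / (64 * (β + 1) ^ 2) := min_le_left _ _
    have hδ2 : δ ≤ 1 / (4 * (β + 1)) := min_le_right _ _
    have hsq : Real.sqrt δ ≤ Real.sqrt ν / (8 * (β + 1)) := by
      rw [Real.sqrt_le_left (by positivity)]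
      calc δ ≤ ν / (64 * (β + 1) ^ 2) := hδ1
        _ = (Real.sqrt ν / (8 * (β + 1))) ^ 2 := by
            rw [div_pow, Real.sq_sqrt hν.le]; ring
    have hνs : ν ^ (-(1 / 2 : ℝ)) * Real.sqrt ν = 1 := by
      rw [Real.sqrt_eq_rpow, ← Real.rpow_add hν]; norm_num
    have hfrac : β / (β + 1) ≤ 1 := by rw [div_le_one hb1]; linarith
    have h1 : β * (2 * ν ^ (-(1 / 2 : ℝ)) * Real.sqrt δ) ≤ 1 / 4 := by
      calc β * (2 * ν ^ (-(1 / 2 : ℝ)) * Real.sqrt δ)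
          ≤ β * (2 * ν ^ (-(1 / 2 : ℝ)) * (Real.sqrt ν / (8 * (β + 1)))) := by gcongr
        _ = (β / (β + 1)) / 4 * (ν ^ (-(1 / 2 : ℝ)) * Real.sqrt ν) := by
            field_simp
            ring
        _ = (β / (β + 1)) / 4 := by rw [hνs, mul_one]
        _ ≤ 1 / 4 := by linarith
    have h2 : β * δ ≤ 1 / 4 := by
      calc β * δ ≤ β * (1 / (4 * (β + 1))) := mul_le_mul_of_nonneg_left hδ2 hβ0
        _ = (β / (β + 1)) / 4 := by field_simp
        _ ≤ 1 / 4 := by linarith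
    calc β * (2 * ν ^ (-(1 / 2 : ℝ)) * Real.sqrt δ + δ)
        = β * (2 * ν ^ (-(1 / 2 : ℝ)) * Real.sqrt δ) + β * δ := by ring
      _ ≤ 1 / 4 + 1 / 4 := add_le_add h1 h2
      _ = 1 / 2 := by norm_num
  clear_value δ
  -- `α` and `q`
  set α : ℝ := A₀ + C_G * (1 + (ν * T₁) ^ (3 / 2 : ℝ)) * A₀ +
    β * A₁ * ((2 * ν ^ (-(1 / 2 : ℝ)) * Real.sqrt T₁ + T₁) + ((ν * T₁) ^ (-(1 / 2 : ℝ)) + 1) * T₁)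
    with hα
  have hα0 : 0 ≤ α := by positivity
  clear_value α
  set q : ℝ := 2 * (β * (((ν * δ) ^ (-(1 / 2 : ℝ)) + 1) * T₁)) with hq
  have hq0 : 0 ≤ q := by positivity
  clear_value q
  -- the explicit envelope `F k = (2α + q A₀) (1 + q)^k`
  set F : ℕ → ℝ := fun k => (2 * α + q * A₀) * (1 + q) ^ k with hF
  have hF0 : F 0 = 2 * α + q * A₀ := by rw [hF]; simp
  have hFstep : ∀ k, 2 * α + q * F k ≤ F (k + 1) := by
    intro k
    rw [hF]; dsimp only
    have h1 : (1 : ℝ) ≤ (1 + q) ^ k := one_le_pow₀ (by linarith)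
    have h2 : 0 ≤ 2 * α + q * A₀ := by positivity
    have h3 : 2 * α ≤ (2 * α + q * A₀) * (1 + q) ^ k := by nlinarith
    calc 2 * α + q * ((2 * α + q * A₀) * (1 + q) ^ k)
        ≤ (2 * α + q * A₀) * (1 + q) ^ k + q * ((2 * α + q * A₀) * (1 + q) ^ k) := by linarith
      _ = (2 * α + q * A₀) * (1 + q) ^ (k + 1) := by ring
  have hFmono : ∀ k j, k ≤ j → F k ≤ F j := by
    intro k j hkj
    rw [hF]; dsimp only
    exact mul_le_mul_of_nonneg_left (pow_le_pow_right₀ (by linarith) hkj) (by positivity)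
  clear_value F
  set N : ℕ := ⌈T₁ / δ⌉₊ with hN
  refine ⟨F N, ?_⟩
  -- the data
  intro ι _ g a b hcard hg0c hg0 hgL hlist hrep
  -- the truncated weighted suprema `Φ R t = sup {w_R(y) |g(τ, y)| : τ ∈ [0, t], y}`
  have hwle : ∀ {R : ℝ}, 1 ≤ R → ∀ y : EuclideanSpace ℝ (Fin 3), (min (1 + ‖y‖) R) ^ 3 ≤ R ^ 3 :=
    fun {R} hR y => pow_le_pow_left₀ (le_min (by positivity) (by linarith)) (min_le_right _ _) 3
  set Φ : ℝ → ℝ → ℝ := fun R t => sSup ((fun p : ℝ × EuclideanSpace ℝ (Fin 3) =>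
    (min (1 + ‖p.2‖) R) ^ 3 * ‖g p.1 p.2‖) '' (Icc 0 t ×ˢ univ)) with hΦ
  have hbdd : ∀ {R : ℝ}, 1 ≤ R → ∀ {t : ℝ}, t ≤ T₁ →
      BddAbove ((fun p : ℝ × EuclideanSpace ℝ (Fin 3) =>
        (min (1 + ‖p.2‖) R) ^ 3 * ‖g p.1 p.2‖) '' (Icc 0 t ×ˢ univ)) := by
    intro R hR t ht
    refine ⟨R ^ 3 * L, ?_⟩
    rintro _ ⟨⟨τ, y⟩, ⟨hτ, -⟩, rfl⟩
    exact mul_le_mul (hwle hR y) (hgL τ ⟨hτ.1, hτ.2.trans ht⟩ y) (norm_nonneg _) (by positivity)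
  have hne : ∀ (R : ℝ) {t : ℝ}, 0 ≤ t →
      ((fun p : ℝ × EuclideanSpace ℝ (Fin 3) =>
        (min (1 + ‖p.2‖) R) ^ 3 * ‖g p.1 p.2‖) '' (Icc 0 t ×ˢ univ)).Nonempty :=
    fun R {t} ht => ⟨_, ⟨(0, 0), ⟨⟨le_rfl, ht⟩, mem_univ _⟩, rfl⟩⟩
  have hP1 : ∀ {R : ℝ}, 1 ≤ R → ∀ {t : ℝ}, t ≤ T₁ → ∀ τ ∈ Icc 0 t, ∀ y,
      (min (1 + ‖y‖) R) ^ 3 * ‖g τ y‖ ≤ Φ R t := by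
    intro R hR t ht τ hτ y
    exact le_csSup (hbdd hR ht) ⟨(τ, y), ⟨hτ, mem_univ _⟩, rfl⟩
  have hP2 : ∀ (R : ℝ) {t : ℝ}, 0 ≤ t → ∀ {M : ℝ},
      (∀ τ ∈ Icc 0 t, ∀ y, (min (1 + ‖y‖) R) ^ 3 * ‖g τ y‖ ≤ M) → Φ R t ≤ M := by
    intro R t ht M hM
    refine csSup_le (hne R ht) ?_
    rintro _ ⟨⟨τ, y⟩, ⟨hτ, -⟩, rfl⟩
    exact hM τ hτ y
  have hP3 : ∀ {R : ℝ}, 1 ≤ R → ∀ {t : ℝ}, 0 ≤ t → t ≤ T₁ → 0 ≤ Φ R t := by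
    intro R hR t ht htT
    exact le_trans (by positivity) (hP1 hR htT 0 ⟨le_rfl, ht⟩ 0)
  have hP4 : ∀ {R : ℝ}, 1 ≤ R → ∀ {t t' : ℝ}, 0 ≤ t → t ≤ t' → t' ≤ T₁ → Φ R t ≤ Φ R t' := by
    intro R hR t t' ht htt' ht'
    exact csSup_le_csSup (hbdd hR ht') (hne R ht)
      (image_mono (prod_mono (Icc_subset_Icc_right htt') subset_rfl))
  have hP5 : ∀ {R : ℝ}, 1 ≤ R → Φ R 0 ≤ A₀ := by
    intro R hR
    refine hP2 R le_rfl fun τ hτ y => ?_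
    have hτ0 : τ = 0 := le_antisymm hτ.2 hτ.1
    rw [hτ0]
    exact le_trans (mul_le_mul_of_nonneg_right (decay_weight_le_cube R y) (norm_nonneg _)) (hg0 y)
  clear_value Φ
  -- (G) the one-step inequality with the singular part absorbed
  have hG' : ∀ {R : ℝ}, 1 ≤ R → ∀ t ∈ Icc 0 T₁, Φ R t ≤ 2 * α + q * Φ R (max (t - δ) 0) := by
    intro R hR t ht
    have h := decay_bootstrap_step hC₀ hC_K hC_G hK hW (hG (F := EuclideanSpace ℝ (Fin 3))) hν hT₁
      hL hA₀ hA₁ hcard hg0c hg0 hlist hrep hR (Φ R) (hP1 hR) (hP2 R) (hP3 hR) (hP4 hR) hδ0 ht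
    rw [← hβ, ← hα] at h
    have hΦt0 : 0 ≤ Φ R t := hP3 hR ht.1 ht.2
    have habs : β * (2 * ν ^ (-(1 / 2 : ℝ)) * Real.sqrt δ + δ) * Φ R t ≤ 1 / 2 * Φ R t :=
      mul_le_mul_of_nonneg_right hβI hΦt0
    have hqq : β * (((ν * δ) ^ (-(1 / 2 : ℝ)) + 1) * T₁) * Φ R (max (t - δ) 0) =
        q / 2 * Φ R (max (t - δ) 0) := by rw [hq]; ring
    rw [hqq] at h
    linarith
  -- the induction over steps of length `δ`
  have hclaim : ∀ {R : ℝ}, 1 ≤ R → ∀ k : ℕ, ∀ t ∈ Icc 0 T₁, t ≤ (k + 1) * δ → Φ R t ≤ F k := by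
    intro R hR k
    induction k with
    | zero =>
      intro t ht htk
      have hmax : max (t - δ) 0 = 0 := max_eq_right (by norm_num at htk; linarith)
      have h := hG' hR t ht
      rw [hmax] at h
      have h2 := mul_le_mul_of_nonneg_left (hP5 hR) hq0
      rw [hF0]
      linarith
    | succ k ih =>
      intro t ht htk
      rcases le_or_gt t δ with htδ | htδ
      · have hmax : max (t - δ) 0 = 0 := max_eq_right (by linarith)
        have h := hG' hR t ht
        rw [hmax] at h
        have h2 := mul_le_mul_of_nonneg_left (hP5 hR) hq0
        refine le_trans ?_ (hFmono 0 (k + 1) (Nat.zero_le _))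
        rw [hF0]
        linarith
      · have hmax : max (t - δ) 0 = t - δ := max_eq_left (by linarith)
        have h := hG' hR t ht
        rw [hmax] at h
        have htd : t - δ ∈ Icc 0 T₁ := ⟨by linarith, by linarith [ht.2]⟩
        have htdk : t - δ ≤ (k + 1) * δ := by push_cast at htk ⊢; linarith
        have hih := ih (t - δ) htd htdk
        have h2 := mul_le_mul_of_nonneg_left hih hq0
        refine le_trans ?_ (hFstep k)
        linarith
  -- conclusion: take `R = 1 + |x|`
  intro τ hτ x
  have hR1 : (1 : ℝ) ≤ 1 + ‖x‖ := by linarith [norm_nonneg x]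
  have hw : (min (1 + ‖x‖) (1 + ‖x‖)) ^ 3 = (1 + ‖x‖) ^ 3 := by rw [min_self]
  have hTN : T₁ ≤ (N + 1) * δ := by
    have h1 : T₁ / δ ≤ N := Nat.le_ceil _
    have h2 : T₁ ≤ N * δ := by rwa [div_le_iff₀ hδ0] at h1
    nlinarith
  have h := hclaim hR1 N τ hτ (hτ.2.trans hTN)
  calc (1 + ‖x‖) ^ 3 * ‖g τ x‖ = (min (1 + ‖x‖) (1 + ‖x‖)) ^ 3 * ‖g τ x‖ := by rw [hw]
    _ ≤ Φ (1 + ‖x‖) τ := hP1 hR1 hτ.2 τ ⟨hτ.1, le_rfl⟩ x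
    _ ≤ F N := h

end Summit.NavierStokesRegularity.NavierStokesRegularity.Theorems.SlicedKelvinPlanarFluxAPriori

end
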